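import Summits.KontsevichZagierPeriods.KontsevichZagierPeriods.Theorems.RootDecompRelativeModAbsoluteCylLogSplitP11

/-! # `RootDecompRelativeModAbsoluteCylLogSplitP12` — part 12/25 of the mechanical ≤330-line split of `CylLogSplit.lean`
(split by the decomp-kz census seat for landing; mathematics unchanged; part 12 continues part 11). -/

noncomputable section
open Set MeasureTheory Filter Topology
open scoped BigOperators
open Literature.NumberTheory.Transcendental Literature.ModelTheory.ExponentialFields

namespace Summit.KontsevichZagierPeriods.RootDecompRelativeModAbsolute.Rung30571

namespace RegularisedLogLayer

namespace CylLog
variable {b : ℕ}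

namespace DegenerateInstance

/-- Bounded semialgebraic functions on sets of finite measure are integrable. -/
theorem integrableOn_of_abs_le {n : ℕ} {s : Set (Fin n → ℝ)} (hs : IsSemialgebraic ℚ s)
    (hfin : volume s < ⊤) {f : (Fin n → ℝ) → ℝ} (hf : IsSemialgebraicFunOn ℚ s f) (C : ℝ)
    (hC : ∀ z ∈ s, |f z| ≤ C) : IntegrableOn f s := by
  have hsm : MeasurableSet s := hs.measurableSet_holds
  haveI : IsFiniteMeasure (volume.restrict s) := ⟨by rwa [Measure.restrict_apply_univ]⟩
  refine Integrable.mono' (integrable_const C)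
    (KZ.aestronglyMeasurable_of_isSemialgebraicFunOn hf hsm) ?_
  filter_upwards [ae_restrict_mem hsm] with z hz
  rw [Real.norm_eq_abs]
  exact hC z hz

/-- `band ⊆ Icc`. [bookkeeping] -/
theorem band_subset_Icc :
    KZlog.band G (fun _ => (0:ℝ)) (fun _ => 1) ⊆ Icc (0 : Fin (1 + 1) → ℝ) 1 := by
  intro z hz
  obtain ⟨⟨h0, h1⟩, h2, h3⟩ := hz
  rw [mem_Icc, Pi.le_def, Pi.le_def]
  refine ⟨fun i => ?_, fun i => ?_⟩
  · rcases Fin.eq_castSucc_or_eq_last i with ⟨j, rfl⟩ | rfl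
    · rw [Fin.eq_zero j]; exact h0.le
    · exact h2
  · rcases Fin.eq_castSucc_or_eq_last i with ⟨j, rfl⟩ | rfl
    · rw [Fin.eq_zero j]; exact h1.le
    · exact h3

/-- `cyl ⊆ band`. [bookkeeping] -/
theorem cyl_subset_band : cyl ⊆ KZlog.band G (fun _ => (0:ℝ)) (fun _ => 1) :=
  fun _ hz => ⟨hz.1, hz.2.1.le, hz.2.2.le⟩

/-- Auxiliary step `volume_band_lt_top`. [bookkeeping] -/
theorem volume_band_lt_top : volume (KZlog.band G (fun _ => (0:ℝ)) (fun _ => 1)) < ⊤ :=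
  lt_of_le_of_lt (measure_mono band_subset_Icc) (by simp [Real.volume_Icc_pi])

/-- Auxiliary step `volume_cyl_lt_top`. [bookkeeping] -/
theorem volume_cyl_lt_top : volume cyl < ⊤ :=
  lt_of_le_of_lt (measure_mono cyl_subset_band) volume_band_lt_top

/-- `ρ_1(u,w) = (u−1)(w−1)`. -/
theorem rho_one_eq (u w : ℝ) : rho 1 u w = (u - 1) * (w - 1) := by
  simp [rho, polyLog]
  ring

/-- **The degenerate two-term family is a Kontsevich–Zagier relation**, decided inside `KZ.relations` by the
node's moves only (integrand split, open→closed, D4 substitution, the (+,+) regularised torus product,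
Newton–Leibniz for the constant, base cancellation).  Any honest `V` on the open square with this integrand. -/
theorem degenerateFamily_mem_relations (V : KZ.IntegralRep (1 + 1)) (hVd : V.domain = cyl)
    (hVi : ∀ z ∈ cyl, V.integrand z = 1 + term c₁ κ₁ z + term c₂ κ₂ z) :
    KZ.of V ∈ KZ.relations := by
  have hG := isSemialgebraic_G
  have hGo := isOpen_G
  have hcyl := isSemialgebraic_cyl
  have h0sa : IsSemialgebraicFunOn ℚ G (fun _ => (0:ℝ)) :=
    (isSemialgebraicFunOn_ratCast hG 0).congr fun _ _ => by simp
  have h1sa : IsSemialgebraicFunOn ℚ G (fun _ => (1:ℝ)) :=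
    (isSemialgebraicFunOn_ratCast hG 1).congr fun _ _ => by simp
  have hband : IsSemialgebraic ℚ (KZlog.band G (fun _ => (0:ℝ)) (fun _ => 1)) :=
    KZlog.isSemialgebraic_band h0sa h1sa
  have hcylG : cyl ⊆ {z | (Fin.init z : Fin 1 → ℝ) ∈ G} := fun z hz => hz.1
  have hbandG : KZlog.band G (fun _ => (0:ℝ)) (fun _ => 1) ⊆ {z | (Fin.init z : Fin 1 → ℝ) ∈ G} :=
    fun z hz => hz.1
  -- no poles
  have hden₁ : ∀ z ∈ KZlog.band G (fun _ => (0:ℝ)) (fun _ => 1),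
      1 + z (Fin.last 1) * κ₁ (Fin.init z) ≠ 0 := fun z hz => by
    have hx : 0 < Fin.init z 0 := hz.1.1
    have hθ : 0 ≤ z (Fin.last 1) := hz.2.1
    simp only [κ₁]
    positivity
  have hden₂ : ∀ z ∈ KZlog.band G (fun _ => (0:ℝ)) (fun _ => 1),
      1 + z (Fin.last 1) * κ₂ (Fin.init z) ≠ 0 := fun z hz => by
    have hx : 0 < Fin.init z 0 := hz.1.1
    have hθ : 0 ≤ z (Fin.last 1) := hz.2.1
    simp only [κ₂]
    positivity
  have hden₁c : ∀ z ∈ cyl, 1 + z (Fin.last 1) * κ₁ (Fin.init z) ≠ 0 :=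
    fun z hz => hden₁ z (cyl_subset_band hz)
  have hden₂c : ∀ z ∈ cyl, 1 + z (Fin.last 1) * κ₂ (Fin.init z) ≠ 0 :=
    fun z hz => hden₂ z (cyl_subset_band hz)
  -- semialgebraicity of the pieces
  have hsa₁c : IsSemialgebraicFunOn ℚ cyl (term c₁ κ₁) := sa_term hcyl hcylG sa_c₁ sa_κ₁ hden₁c
  have hsa₂c : IsSemialgebraicFunOn ℚ cyl (term c₂ κ₂) := sa_term hcyl hcylG sa_c₂ sa_κ₂ hden₂c
  have hsa₁b : IsSemialgebraicFunOn ℚ (KZlog.band G (fun _ => (0:ℝ)) (fun _ => 1)) (term c₁ κ₁) :=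
    sa_term hband hbandG sa_c₁ sa_κ₁ hden₁
  have hsa₂b : IsSemialgebraicFunOn ℚ (KZlog.band G (fun _ => (0:ℝ)) (fun _ => 1)) (term c₂ κ₂) :=
    sa_term hband hbandG sa_c₂ sa_κ₂ hden₂
  have h1c : IsSemialgebraicFunOn ℚ cyl (fun _ => (1:ℝ)) :=
    (isSemialgebraicFunOn_ratCast hcyl 1).congr fun _ _ => by simp
  have h1b : IsSemialgebraicFunOn ℚ (KZlog.band G (fun _ => (0:ℝ)) (fun _ => 1)) (fun _ => (1:ℝ)) :=
    (isSemialgebraicFunOn_ratCast hband 1).congr fun _ _ => by simp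
  have hV₁sa : IsSemialgebraicFunOn ℚ cyl (fun z => 1 + term c₁ κ₁ z) :=
    IsSemialgebraicFunOn.add_holds h1c hsa₁c
  -- bounds (every representation below is honest because bounded on a bounded cell)
  have hc₂G : ∀ x ∈ G, |c₂ x| ≤ 9 := fun x hx => by
    simp only [c₂, abs_neg]
    rw [abs_of_nonneg (sq_nonneg _)]
    nlinarith [hx.1, hx.2]
  have hb₁ : ∀ z ∈ KZlog.band G (fun _ => (0:ℝ)) (fun _ => 1), |term c₁ κ₁ z| ≤ 2 := fun z hz =>
    (abs_term_le hz.2.1 hz.2.2 (κ₁_pos _ hz.1).le).trans (by norm_num [c₁])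
  have hb₂ : ∀ z ∈ KZlog.band G (fun _ => (0:ℝ)) (fun _ => 1), |term c₂ κ₂ z| ≤ 9 := fun z hz =>
    (abs_term_le hz.2.1 hz.2.2 (κ₂_pos _ hz.1).le).trans (hc₂G _ hz.1)
  have hb₁c : ∀ z ∈ cyl, |term c₁ κ₁ z| ≤ 2 := fun z hz => hb₁ z (cyl_subset_band hz)
  have hb₂c : ∀ z ∈ cyl, |term c₂ κ₂ z| ≤ 9 := fun z hz => hb₂ z (cyl_subset_band hz)
  have hbV₁ : ∀ z ∈ cyl, |1 + term c₁ κ₁ z| ≤ 3 := fun z hz =>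
    (abs_add_le _ _).trans (by rw [abs_one]; linarith [hb₁c z hz])
  -- the representations on the open square
  let A₀ : KZ.IntegralRep (1 + 1) :=
    { domain := cyl, integrand := fun _ => 1, isSemialgebraic_domain := hcyl,
      isSemialgebraicFunOn_integrand := h1c,
      integrableOn := integrableOn_of_abs_le hcyl volume_cyl_lt_top h1c 1 fun _ _ => by simp }
  let Cy₁ : KZ.IntegralRep (1 + 1) :=
    { domain := cyl, integrand := term c₁ κ₁, isSemialgebraic_domain := hcyl,
      isSemialgebraicFunOn_integrand := hsa₁c,
      integrableOn := integrableOn_of_abs_le hcyl volume_cyl_lt_top hsa₁c 2 hb₁c }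
  let Cy₂ : KZ.IntegralRep (1 + 1) :=
    { domain := cyl, integrand := term c₂ κ₂, isSemialgebraic_domain := hcyl,
      isSemialgebraicFunOn_integrand := hsa₂c,
      integrableOn := integrableOn_of_abs_le hcyl volume_cyl_lt_top hsa₂c 9 hb₂c }
  let V₁ : KZ.IntegralRep (1 + 1) :=
    { domain := cyl, integrand := fun z => 1 + term c₁ κ₁ z, isSemialgebraic_domain := hcyl,
      isSemialgebraicFunOn_integrand := hV₁sa,
      integrableOn := integrableOn_of_abs_le hcyl volume_cyl_lt_top hV₁sa 3 hbV₁ }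
  -- (1) split the integrand
  have r1 : KZ.of V - KZ.of V₁ - KZ.of Cy₂ ∈ KZ.relations :=
    KZ.integrandAddRel_subset_relations ⟨1 + 1, V, V₁, Cy₂, by rw [hVd], by rw [hVd],
      fun z hz => by rw [hVi z (hVd ▸ hz)]; rfl, rfl⟩
  have r2 : KZ.of V₁ - KZ.of A₀ - KZ.of Cy₁ ∈ KZ.relations :=
    KZ.integrandAddRel_subset_relations ⟨1 + 1, V₁, A₀, Cy₁, rfl, rfl, fun z _ => rfl, rfl⟩
  -- (2) open square → closed band
  obtain ⟨A₀', hA₀'d, hA₀'i, r3⟩ := exists_closedBand_of_openCell' (a := fun _ => (0:ℝ))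
    (c := fun _ => (1:ℝ)) h0sa h1sa A₀ rfl (fun _ => (1:ℝ)) h1b (fun _ _ => rfl)
  obtain ⟨Cy₁', hCy₁'d, hCy₁'i, r4⟩ := exists_closedBand_of_openCell' (a := fun _ => (0:ℝ))
    (c := fun _ => (1:ℝ)) h0sa h1sa Cy₁ rfl (term c₁ κ₁) hsa₁b (fun _ _ => rfl)
  obtain ⟨Cy₂', hCy₂'d, hCy₂'i, r5⟩ := exists_closedBand_of_openCell' (a := fun _ => (0:ℝ))
    (c := fun _ => (1:ℝ)) h0sa h1sa Cy₂ rfl (term c₂ κ₂) hsa₂b (fun _ _ => rfl)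
  -- (3) cylinder terms → regularised cells (D4)
  obtain ⟨Rg₁, hRg₁d, hRg₁i, r6⟩ := exists_regRep_sub_mem_relations (M := 1) hGo hG sa_c₁ sa_κ₁
    κ₁_diff κ₁_pos Cy₁' hCy₁'d (fun z _ => by rw [hCy₁'i]; rfl)
  obtain ⟨Rg₂, hRg₂d, hRg₂i, r7⟩ := exists_regRep_sub_mem_relations (M := 1) hGo hG sa_c₂ sa_κ₂
    κ₂_diff κ₂_pos Cy₂' hCy₂'d (fun z _ => by rw [hCy₂'i]; rfl)
  -- (4) the cell P_1(−1/x², 1+x) = −½·P_1(2/x², 1+x), twice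
  have hbR : IsSemialgebraic ℚ Rg₁.domain := Rg₁.isSemialgebraic_domain
  have hRhalf : ∀ q : ℚ, IsSemialgebraicFunOn ℚ Rg₁.domain (fun z => (q : ℝ) * Rg₁.integrand z) :=
    fun q => IsSemialgebraicFunOn.mul_holds (isSemialgebraicFunOn_ratCast hbR q)
      Rg₁.isSemialgebraicFunOn_integrand
  let R₁' : KZ.IntegralRep (1 + 1) :=
    { domain := Rg₁.domain, integrand := fun z => (((-1/2 : ℚ)) : ℝ) * Rg₁.integrand z,
      isSemialgebraic_domain := hbR, isSemialgebraicFunOn_integrand := hRhalf (-1/2),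
      integrableOn := Rg₁.integrableOn.const_mul _ }
  let T : KZ.IntegralRep (1 + 1) :=
    { domain := Rg₁.domain, integrand := fun z => (((1/2 : ℚ)) : ℝ) * Rg₁.integrand z,
      isSemialgebraic_domain := hbR, isSemialgebraicFunOn_integrand := hRhalf (1/2),
      integrableOn := Rg₁.integrableOn.const_mul _ }
  have r8 : KZ.of T - KZ.of Rg₁ - KZ.of R₁' ∈ KZ.relations :=
    KZ.integrandAddRel_subset_relations ⟨1 + 1, T, Rg₁, R₁', rfl, rfl, fun z _ => by
      show (((1/2 : ℚ)) : ℝ) * Rg₁.integrand z =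
        Rg₁.integrand z + (((-1/2 : ℚ)) : ℝ) * Rg₁.integrand z
      push_cast; ring, rfl⟩
  have r9 : KZ.of T + KZ.of R₁' ∈ KZ.relations :=
    KZ.of_add_of_mem_relations_of_eqOn_neg (r := T) (r' := R₁') rfl fun z _ => by
      show (((-1/2 : ℚ)) : ℝ) * Rg₁.integrand z = -((((1/2 : ℚ)) : ℝ) * Rg₁.integrand z)
      push_cast; ring
  -- (5) the (+,+) regularised torus product with d = −1/x², u = w = 1 + x
  have hx0 : ∀ x ∈ G, x 0 ≠ 0 := fun x hx => hx.1.ne'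
  have hd : IsSemialgebraicFunOn ℚ G (fun x => -1 / x 0 ^ 2) :=
    IsSemialgebraicFunOn.div ((isSemialgebraicFunOn_ratCast hG (-1)).congr fun _ _ => by simp)
      (isSemialgebraicFunOn_pow' hG sa_x 2) fun x hx => pow_ne_zero _ (hx0 x hx)
  have hu : IsSemialgebraicFunOn ℚ G (fun x => 1 + x 0) := IsSemialgebraicFunOn.add_holds h1sa sa_x
  have hud : DifferentiableOn ℝ (fun x : Fin 1 → ℝ => 1 + x 0) G :=
    (show Differentiable ℝ (fun x : Fin 1 → ℝ => 1 + x 0) from by fun_prop).differentiableOn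
  have hu1 : ∀ x ∈ G, 1 ≤ 1 + x 0 := fun x hx => by linarith [hx.1]
  have hm1sa : IsSemialgebraicFunOn ℚ G (fun _ => (-1:ℝ)) :=
    (isSemialgebraicFunOn_ratCast hG (-1)).congr fun _ _ => by simp
  let B : KZ.IntegralRep 1 :=
    { domain := G, integrand := fun _ => -1, isSemialgebraic_domain := hG,
      isSemialgebraicFunOn_integrand := hm1sa,
      integrableOn := integrableOn_of_abs_le hG volume_G_lt_top hm1sa 1 fun _ _ => by simp }
  let Bone : KZ.IntegralRep 1 :=
    { domain := G, integrand := fun _ => 1, isSemialgebraic_domain := hG,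
      isSemialgebraicFunOn_integrand := h1sa,
      integrableOn := integrableOn_of_abs_le hG volume_G_lt_top h1sa 1 fun _ _ => by simp }
  have hR'i : EqOn R₁'.integrand
      (fun z => (fun x : Fin 1 → ℝ => -1 / x 0 ^ 2) (Fin.init z) *
        ((z (Fin.last 1) - 1) ^ 1 / z (Fin.last 1))) R₁'.domain := by
    intro z hz
    have hz' : z ∈ KZlog.band G (fun _ => (1:ℝ)) (fun x => 1 + κ₁ x) := hRg₁d ▸ hz
    have hx : Fin.init z 0 ≠ 0 := hx0 _ hz'.1
    show (((-1/2 : ℚ)) : ℝ) * Rg₁.integrand z = _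
    rw [hRg₁i]
    simp only [c₁, κ₁]
    push_cast
    field_simp
    try ring
  have r10 : KZ.of Rg₂ - KZ.of R₁' - KZ.of R₁' - KZ.of B ∈ KZ.relations := by
    refine regTorusProductPos (m := 1) hGo hG hd hu hu hud hu1 hu1 Rg₂ R₁' R₁' B ?_ ?_ hRg₁d hR'i
      hRg₁d hR'i rfl ?_
    · rw [hRg₂d]
      congr 1
      funext x
      simp only [κ₂]
      ring
    · intro z hz
      have hz' : z ∈ KZlog.band G (fun _ => (1:ℝ)) (fun x => 1 + κ₂ x) := hRg₂d ▸ hz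
      have hx : Fin.init z 0 ≠ 0 := hx0 _ hz'.1
      have hxp : 0 < Fin.init z 0 := hz'.1.1
      have h2x : (2 : ℝ) + Fin.init z 0 ≠ 0 := by positivity
      have hk2 : 2 * Fin.init z 0 + Fin.init z 0 ^ 2 ≠ 0 := by positivity
      rw [hRg₂i]
      simp only [c₂, κ₂]
      field_simp
      ring
    · intro x hx
      have hx' : x 0 ≠ 0 := hx0 x hx
      show (-1 : ℝ) = -1 / x 0 ^ 2 * rho 1 (1 + x 0) (1 + x 0)
      rw [rho_one_eq]
      field_simp
      ring
  -- (6) the constant cylinder term folds to the base: [band, 1] − [G, 1] ∈ relations (Newton–Leibniz, F = θ)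
  have r11 : KZ.of A₀' - KZ.of Bone ∈ KZ.relations := by
    refine KZ.newtonLeibnizRel_subset_relations ⟨1, A₀', Bone, fun _ => 0, fun _ => 1,
      fun z => z (Fin.last 1), isSemialgebraicFunOn_apply A₀'.isSemialgebraic_domain (Fin.last 1),
      h0sa, h1sa, fun _ _ => zero_le_one, ?_, ?_, ?_, ?_, rfl⟩
    · rw [hA₀'d]; rfl
    · intro x _
      simp only [Fin.snoc_last]
      exact continuousOn_id
    · intro x _ t _
      simp only [Fin.snoc_last, hA₀'i]
      exact hasDerivAt_id' t
    · intro x _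
      show (1:ℝ) = (Fin.snoc x (1:ℝ) : Fin (1 + 1) → ℝ) (Fin.last 1) -
        (Fin.snoc x (0:ℝ) : Fin (1 + 1) → ℝ) (Fin.last 1)
      rw [Fin.snoc_last, Fin.snoc_last]
      norm_num
  have r12 : KZ.of Bone + KZ.of B ∈ KZ.relations :=
    KZ.of_add_of_mem_relations_of_eqOn_neg (r := Bone) (r' := B) rfl fun x _ => by
      show (-1 : ℝ) = -(1 : ℝ)
      ring
  -- (7) assemble
  have e : KZ.of V = (KZ.of V - KZ.of V₁ - KZ.of Cy₂) + (KZ.of V₁ - KZ.of A₀ - KZ.of Cy₁) +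
      (KZ.of A₀ - KZ.of A₀') + (KZ.of Cy₁ - KZ.of Cy₁') + (KZ.of Cy₂ - KZ.of Cy₂') +
      (KZ.of Cy₁' - KZ.of Rg₁) + (KZ.of Cy₂' - KZ.of Rg₂) +
      (KZ.of Rg₂ - KZ.of R₁' - KZ.of R₁' - KZ.of B) +
      (-(KZ.of T - KZ.of Rg₁ - KZ.of R₁') + (KZ.of T + KZ.of R₁')) +
      (KZ.of A₀' - KZ.of Bone) + (KZ.of Bone + KZ.of B) := by
    abel
  rw [e]
  exact add_mem (add_mem (add_mem (add_mem (add_mem (add_mem (add_mem (add_mem (add_mem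
    (add_mem r1 r2) r3) r4) r5) r6) r7) r10) (add_mem (neg_mem r8) r9)) r11) r12

end DegenerateInstance

/-! ### §3n Re-orientation of a pure-log cell (`M = 0`) — the `BoundaryRigidity` interface move (R1), PROVED
`BoundaryRigidity` (tree, `Negative/Rigidity.lean`) takes pure-log cells `[band 1 W, h/t]` with `W ≥ 1`.  A tame
piece with `0 < W < 1` is re-oriented NOT by the inversion `t ↦ 1/t` but by the affine substitution `t = W·s`
(the kernel `dt/t` is scale invariant): `[band G 1 (1/W), h/s] − [band G W 1, h/t]` is ONE rule-2 move. -/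

end CylLog
end RegularisedLogLayer
end Summit.KontsevichZagierPeriods.RootDecompRelativeModAbsolute.Rung30571
end
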